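import Mathlib
import HarnessLib
import Summits.PneNP.PneNP.Theorems.OverlapGapAlgebraSearchHardWindowLocalRungSigns

/-!
# PneNP / OverlapGapAlgebra — `SearchHardWindow`: occurrence-local rung, exponential form and advice

Support for crux `stmt-PneNP-2460` (`Summit.PneNP.PneNP.Theses.OverlapGapAlgebra.SearchHardWindow`),
fifth file of the OCCURRENCE-LOCAL RUNG (prefix `shwL_`; see `…LocalRungCore/Signs/Patterns`,
`…LocalRung`, and `…LocalRungHighDegree`, `…LocalRungAdvice`). Fixed variable pattern `V`:

* `shwL_exists_indepSet` — greedy independent set in a graph of degree `≤ D`: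
  `#G ≤ (D + 1) · #I` [folklore];
* `shwL_card_avoid_le_pow` — for pairwise variable-disjoint clauses each violated with
  probability `≥ 4^{-k}`, the sign patterns violating none of them are a `(1 - 4^{-k})^{#I}`
  fraction (complements of the violation events are determined by disjoint slot blocks, hence
  independent: `shwL_card_forall_mul_pow`);
* `shwL_card_solved_signs_le_pow` — EXPONENTIAL fixed-pattern rung: with a degree cut-off `D`,
  `H` clauses touching a variable of degree `> D` and `ν` bounding systems of distinct
  representatives, `#{S : A S ⊨ (V,S)} ≤ (1 - 4^{-k})^q · 2^{mk}` whenever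
  `(kD + 1) q ≤ #distinct-variable clauses - ν - H` (replaces the Chebyshev step of
  `…LocalRungSigns` by independence along a greedy independent set of good clauses);
* `shwL_card_solved_signs_le_advice` — the same for solvers that are occurrence-local GIVEN an
  advice value `h S ∈ Fin N` (union bound over the `N` fibres, on each of which the solver agrees
  with a genuinely occurrence-local one): `≤ N (1 - 4^{-k})^q · 2^{mk}`.

No definitions; axioms `propext`, `Classical.choice`, `Quot.sound`.
-/

set_option linter.dupNamespace false -- `Summit.PneNP.PneNP.…`: summit = sub-problem (D-0017)

namespace Summit.PneNP.PneNP.Theorems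

open Finset

section IndepSet

variable {ι : Type*} [DecidableEq ι]

/-- **Greedy independent set.** In a finite "graph" given by a symmetric relation in which every
vertex of `G` is related to at most `D` vertices of `G`, there is an independent subset `I`
(no two distinct members related) with `#G ≤ (D + 1) · #I`. [folklore] -/
theorem shwL_exists_indepSet (rel : ι → ι → Prop) [DecidableRel rel]
    (hsymm : ∀ i i', rel i i' → rel i' i) (D : ℕ) :
    ∀ G : Finset ι, (∀ i ∈ G, (G.filter fun i' => rel i i').card ≤ D) →
      ∃ I : Finset ι, I ⊆ G ∧ (∀ i ∈ I, ∀ i' ∈ I, i ≠ i' → ¬ rel i i') ∧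
        G.card ≤ (D + 1) * I.card := by
  intro G
  induction G using Finset.strongInduction with
  | H G ih =>
    intro hD
    rcases G.eq_empty_or_nonempty with hG | ⟨i₀, hi₀⟩
    · exact ⟨∅, by simp [hG]⟩
    -- remove `i₀` and its neighbours
    set G' : Finset ι := (G.erase i₀).filter fun i' => ¬ rel i₀ i' with hG'
    have hG'sub : G' ⊆ G := (filter_subset _ _).trans (erase_subset _ _)
    have hG'ss : G' ⊂ G := Finset.ssubset_iff_subset_ne.2 ⟨hG'sub, fun h => by
      have : i₀ ∈ G' := h ▸ hi₀
      rw [hG', mem_filter] at this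
      exact (Finset.notMem_erase i₀ G) this.1⟩
    have hD' : ∀ i ∈ G', (G'.filter fun i' => rel i i').card ≤ D := fun i hi =>
      (card_le_card (filter_subset_filter _ hG'sub)).trans (hD i (hG'sub hi))
    obtain ⟨I', hI'sub, hI'ind, hI'card⟩ := ih G' hG'ss hD'
    refine ⟨insert i₀ I', ?_, ?_, ?_⟩
    · exact insert_subset hi₀ (hI'sub.trans hG'sub)
    · intro i hi i' hi' hne
      rw [mem_insert] at hi hi'
      have key : ∀ j ∈ I', ¬ rel i₀ j := fun j hj => by
        have := hI'sub hj
        rw [hG', mem_filter] at this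
        exact this.2
      rcases hi with rfl | hi <;> rcases hi' with rfl | hi'
      · exact absurd rfl hne
      · exact key i' hi'
      · exact fun h => key i hi (hsymm _ _ h)
      · exact hI'ind i hi i' hi' hne
    · -- `G ⊆ G' ∪ {i₀} ∪ neighbours of i₀`
      have hcover : G ⊆ G' ∪ (insert i₀ (G.filter fun i' => rel i₀ i')) := by
        intro i hi
        by_cases h : i = i₀
        · subst h; exact mem_union_right _ (mem_insert_self _ _)
        by_cases hr : rel i₀ i
        · exact mem_union_right _ (mem_insert_of_mem (mem_filter.2 ⟨hi, hr⟩))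
        · exact mem_union_left _ (by rw [hG', mem_filter]; exact ⟨mem_erase.2 ⟨h, hi⟩, hr⟩)
      have hi₀I' : i₀ ∉ I' := fun h => by
        have := hI'sub h
        rw [hG', mem_filter] at this
        exact (Finset.notMem_erase i₀ G) this.1
      rw [card_insert_of_notMem hi₀I']
      calc G.card ≤ (G' ∪ insert i₀ (G.filter fun i' => rel i₀ i')).card := card_le_card hcover
        _ ≤ G'.card + (insert i₀ (G.filter fun i' => rel i₀ i')).card := card_union_le _ _
        _ ≤ G'.card + ((G.filter fun i' => rel i₀ i').card + 1) :=
            Nat.add_le_add_left (card_insert_le _ _) _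
        _ ≤ (D + 1) * I'.card + (D + 1) := by
            have := hD i₀ hi₀; omega
        _ = (D + 1) * (I'.card + 1) := by ring

end IndepSet

section ExpSigns

variable {m k n : ℕ}

/-- **Dependency degree, local form.** A clause all of whose variables occur in at most `D` slots
shares a variable with at most `k · D` clauses (of any set `G`). -/
theorem shwL_card_rel_le_low (V : Fin m × Fin k → Fin n) (D : ℕ) (i : Fin m)
    (hi : ∀ j : Fin k, (univ.filter fun a : Fin m × Fin k => V a = V (i, j)).card ≤ D)
    (G : Finset (Fin m)) :
    (G.filter fun i' => ∃ j j', V (i, j) = V (i', j')).card ≤ k * D := by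
  have hsub : (G.filter fun i' => ∃ j j', V (i, j) = V (i', j'))
      ⊆ (univ : Finset (Fin k)).biUnion fun j =>
          (univ.filter fun a : Fin m × Fin k => V a = V (i, j)).image Prod.fst := by
    intro i' hi'
    simp only [mem_filter] at hi'
    obtain ⟨-, j, j', hjj'⟩ := hi'
    simp only [mem_biUnion, mem_univ, true_and, mem_image, mem_filter]
    exact ⟨j, (i', j'), hjj'.symm, rfl⟩
  calc (G.filter fun i' => ∃ j j', V (i, j) = V (i', j')).card
      ≤ ∑ j : Fin k, ((univ.filter fun a : Fin m × Fin k => V a = V (i, j)).image Prod.fst).card :=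
        (card_le_card hsub).trans card_biUnion_le
    _ ≤ ∑ _j : Fin k, D := sum_le_sum fun j _ => card_image_le.trans (hi j)
    _ = k * D := by rw [sum_const, card_univ, Fintype.card_fin, smul_eq_mul]

/-- **Independent good clauses multiply.** For an occurrence-local solver on a fixed variable
pattern and a family `I` of clauses with pairwise disjoint variable sets, each violated on at
least a `4^{-k}` fraction of the sign cube, the sign patterns violating NO clause of `I` number at
most `(1 - 4^{-k})^{#I} · 2^{mk}`: the complements of the violation events are determined by
pairwise disjoint slot blocks, hence independent (`shwL_card_forall_mul_pow`). -/
theorem shwL_card_avoid_le_pow (V : Fin m × Fin k → Fin n)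
    (A : (Fin m × Fin k → Bool) → (Fin n → Bool))
    (hA : ∀ v : Fin n, ∀ S S' : Fin m × Fin k → Bool,
      (∀ a, V a = v → S a = S' a) → A S v = A S' v)
    (I : Finset (Fin m))
    (hI : ∀ i ∈ I, ∀ i' ∈ I, i ≠ i' → ∀ j j', V (i, j) ≠ V (i', j'))
    (hgood : ∀ i ∈ I, Fintype.card (Fin m × Fin k → Bool)
      ≤ 4 ^ k * (univ.filter fun S : Fin m × Fin k → Bool => ∀ j, A S (V (i, j)) ≠ S (i, j)).card) :
    ((univ.filter fun S : Fin m × Fin k → Bool =>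
        ∀ i ∈ I, ∃ j, A S (V (i, j)) = S (i, j)).card : ℝ)
      ≤ (1 - (1 / 4 : ℝ) ^ k) ^ I.card * Fintype.card (Fin m × Fin k → Bool) := by
  -- complements of the violation events, determined by the slot blocks of the clauses
  have hprod := shwL_card_forall_mul_pow I
    (fun i => univ.filter fun a : Fin m × Fin k => ∃ j, V a = V (i, j))
    (fun i => univ.filter fun S : Fin m × Fin k → Bool => ∃ j, A S (V (i, j)) = S (i, j))
    (fun i _ S S' hSS' => by
      simp only [mem_filter, mem_univ, true_and] at hSS' ⊢
      refine exists_congr fun j => ?_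
      rw [hA (V (i, j)) S S' fun a ha => hSS' a ⟨j, ha⟩, hSS' (i, j) ⟨j, rfl⟩])
    (fun i hi i' hi' hne => by
      refine Finset.disjoint_left.2 fun a ha ha' => ?_
      simp only [mem_filter, mem_univ, true_and] at ha ha'
      obtain ⟨j, hj⟩ := ha
      obtain ⟨j', hj'⟩ := ha'
      exact hI i hi i' hi' hne j j' (hj.symm.trans hj'))
  set N := Fintype.card (Fin m × Fin k → Bool) with hN
  have hNpos : (0 : ℝ) < N := by rw [hN]; exact_mod_cast Fintype.card_pos
  -- each complement has at most `(1 - 4^{-k}) N` elements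
  have hcomp : ∀ i ∈ I, (((univ.filter fun S : Fin m × Fin k → Bool =>
      ∃ j, A S (V (i, j)) = S (i, j)).card : ℕ) : ℝ) ≤ (1 - (1 / 4 : ℝ) ^ k) * N := by
    intro i hi
    have hsplit := Finset.card_filter_add_card_filter_not (s := (univ : Finset (Fin m × Fin k → Bool)))
      (fun S => ∃ j, A S (V (i, j)) = S (i, j))
    rw [card_univ, ← hN] at hsplit
    have hg := hgood i hi
    have hnot : (univ.filter fun S : Fin m × Fin k → Bool => ¬ ∃ j, A S (V (i, j)) = S (i, j))
        = univ.filter fun S : Fin m × Fin k → Bool => ∀ j, A S (V (i, j)) ≠ S (i, j) := by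
      congr 1; ext S; simp
    rw [hnot] at hsplit
    have h4 : (0 : ℝ) < (4 : ℝ) ^ k := by positivity
    have hgR : (N : ℝ) ≤ (4 : ℝ) ^ k * ((univ.filter fun S : Fin m × Fin k → Bool =>
        ∀ j, A S (V (i, j)) ≠ S (i, j)).card : ℝ) := by exact_mod_cast hg
    have hsR : (((univ.filter fun S : Fin m × Fin k → Bool =>
        ∃ j, A S (V (i, j)) = S (i, j)).card : ℕ) : ℝ)
          + ((univ.filter fun S : Fin m × Fin k → Bool => ∀ j, A S (V (i, j)) ≠ S (i, j)).card : ℝ)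
          = N := by exact_mod_cast hsplit
    have h14 : (1 / 4 : ℝ) ^ k = 1 / (4 : ℝ) ^ k := by rw [one_div, one_div, inv_pow]
    have hdiv : (N : ℝ) / (4 : ℝ) ^ k ≤ ((univ.filter fun S : Fin m × Fin k → Bool =>
        ∀ j, A S (V (i, j)) ≠ S (i, j)).card : ℝ) := by
      rw [div_le_iff₀' h4]; exact hgR
    have hexp : (1 - 1 / (4 : ℝ) ^ k) * N = N - N / (4 : ℝ) ^ k := by ring
    rw [h14, hexp]
    linarith [hdiv, hsR]
  -- multiply (restate `hprod` with the locally synthesised decidability instances)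
  have hprodN : (univ.filter fun S : Fin m × Fin k → Bool => ∀ i ∈ I,
      S ∈ (univ.filter fun S : Fin m × Fin k → Bool => ∃ j, A S (V (i, j)) = S (i, j))).card
        * N ^ I.card
      = (∏ i ∈ I, (univ.filter fun S : Fin m × Fin k → Bool =>
          ∃ j, A S (V (i, j)) = S (i, j)).card) * N := by
    convert hprod using 4
  have hprodR : (((univ.filter fun S : Fin m × Fin k → Bool => ∀ i ∈ I,
      S ∈ (univ.filter fun S : Fin m × Fin k → Bool => ∃ j, A S (V (i, j)) = S (i, j))).card : ℕ) : ℝ)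
        * (N : ℝ) ^ I.card
      = (∏ i ∈ I, (((univ.filter fun S : Fin m × Fin k → Bool =>
          ∃ j, A S (V (i, j)) = S (i, j)).card : ℕ) : ℝ)) * N := by
    exact_mod_cast hprodN
  have hle : (∏ i ∈ I, (((univ.filter fun S : Fin m × Fin k → Bool =>
      ∃ j, A S (V (i, j)) = S (i, j)).card : ℕ) : ℝ)) ≤ ∏ _i ∈ I, ((1 - (1 / 4 : ℝ) ^ k) * N) :=
    prod_le_prod (fun i _ => Nat.cast_nonneg _) hcomp
  rw [prod_const, mul_pow] at hle
  have hset : (univ.filter fun S : Fin m × Fin k → Bool => ∀ i ∈ I, ∃ j, A S (V (i, j)) = S (i, j))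
      = univ.filter fun S : Fin m × Fin k → Bool => ∀ i ∈ I,
          S ∈ (univ.filter fun S : Fin m × Fin k → Bool => ∃ j, A S (V (i, j)) = S (i, j)) := by
    congr 1; ext S; simp
  rw [hset]
  have hpow : (0 : ℝ) < (N : ℝ) ^ I.card := by positivity
  refine le_of_mul_le_mul_right ?_ hpow
  calc (((univ.filter fun S : Fin m × Fin k → Bool => ∀ i ∈ I,
        S ∈ (univ.filter fun S : Fin m × Fin k → Bool => ∃ j, A S (V (i, j)) = S (i, j))).card : ℕ) : ℝ)
        * (N : ℝ) ^ I.card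
      = (∏ i ∈ I, (((univ.filter fun S : Fin m × Fin k → Bool =>
          ∃ j, A S (V (i, j)) = S (i, j)).card : ℕ) : ℝ)) * N := hprodR
    _ ≤ (1 - (1 / 4 : ℝ) ^ k) ^ I.card * (N : ℝ) ^ I.card * N :=
        mul_le_mul_of_nonneg_right hle hNpos.le
    _ = (1 - (1 / 4 : ℝ) ^ k) ^ I.card * N * (N : ℝ) ^ I.card := by ring

/-- **Occurrence-local rung, one variable pattern — exponential form.** Let `ν` bound every
system of distinct representatives (e.g. `ν = n`), let `D` be a degree cut-off and `H` the number
of clauses containing a variable of degree `> D`. Then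
`#{S : A S ⊨ (V, S)} ≤ (1 - 4^{-k})^q · 2^{mk}` for every `q` with
`(kD + 1) · q ≤ #{clauses with k distinct variables} - ν - H`: the good clauses avoiding the
high-degree variables form a graph of degree `≤ kD` under variable-sharing, so a greedy
independent set has `≥ q` members, whose violation events are independent. -/
theorem shwL_card_solved_signs_le_pow (V : Fin m × Fin k → Fin n)
    (A : (Fin m × Fin k → Bool) → (Fin n → Bool))
    (hA : ∀ v : Fin n, ∀ S S' : Fin m × Fin k → Bool,
      (∀ a, V a = v → S a = S' a) → A S v = A S' v)
    (D : ℕ) (ν : ℕ)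
    (hν : ∀ W : Finset (Fin m × Fin k), Set.InjOn V (W : Set (Fin m × Fin k)) →
      Set.InjOn Prod.fst (W : Set (Fin m × Fin k)) → W.card ≤ ν)
    (q : ℕ) (hq : (k * D + 1) * q
      ≤ (univ.filter fun i : Fin m => Function.Injective fun j : Fin k => V (i, j)).card - ν
        - (univ.filter fun i : Fin m => ∃ j : Fin k,
            D < (univ.filter fun a : Fin m × Fin k => V a = V (i, j)).card).card) :
    ((univ.filter fun S : Fin m × Fin k → Bool =>
        ∀ i : Fin m, ∃ j : Fin k, A S (V (i, j)) = S (i, j)).card : ℝ)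
      ≤ (1 - (1 / 4 : ℝ) ^ k) ^ q * Fintype.card (Fin m × Fin k → Bool) := by
  -- weak slots `W`, high-degree clauses `Hc`, good clauses `G` (kept opaque)
  obtain ⟨W, hW⟩ : ∃ W : Finset (Fin m × Fin k), W = univ.filter fun a : Fin m × Fin k =>
      4 * (univ.filter fun S : Fin m × Fin k → Bool => A S (V a) ≠ S a).card
        < Fintype.card (Fin m × Fin k → Bool) := ⟨_, rfl⟩
  have hWν : (W.image Prod.fst).card ≤ ν := hW ▸ shwL_card_clauses_weak_le V A ν hν
  obtain ⟨Hc, hHc⟩ : ∃ Hc : Finset (Fin m), Hc = univ.filter fun i : Fin m => ∃ j : Fin k,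
      D < (univ.filter fun a : Fin m × Fin k => V a = V (i, j)).card := ⟨_, rfl⟩
  obtain ⟨G, hG⟩ : ∃ G : Finset (Fin m), G = univ.filter fun i : Fin m =>
      (Function.Injective fun j : Fin k => V (i, j)) ∧ (∀ j, (i, j) ∉ W) ∧
        ∀ j, (univ.filter fun a : Fin m × Fin k => V a = V (i, j)).card ≤ D := ⟨_, rfl⟩
  have hDistG : (univ.filter fun i : Fin m => Function.Injective fun j : Fin k => V (i, j)).card
      - ν - Hc.card ≤ G.card := by
    have hsub : (univ.filter fun i : Fin m => Function.Injective fun j : Fin k => V (i, j))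
        ⊆ G ∪ W.image Prod.fst ∪ Hc := by
      intro i hi
      rw [mem_filter] at hi
      by_cases hh : ∀ j, (univ.filter fun a : Fin m × Fin k => V a = V (i, j)).card ≤ D
      · by_cases hw : ∀ j, (i, j) ∉ W
        · exact mem_union_left _ (mem_union_left _
            (by rw [hG, mem_filter]; exact ⟨mem_univ _, hi.2, hw, hh⟩))
        · push Not at hw
          obtain ⟨j, hj⟩ := hw
          exact mem_union_left _ (mem_union_right _ (mem_image.2 ⟨(i, j), hj, rfl⟩))
      · push Not at hh
        obtain ⟨j, hj⟩ := hh
        exact mem_union_right _ (by rw [hHc, mem_filter]; exact ⟨mem_univ _, j, hj⟩)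
    have := (card_le_card hsub).trans ((card_union_le _ _).trans (Nat.add_le_add_right
      ((card_union_le _ _).trans (Nat.add_le_add_left hWν _)) _))
    omega
  -- independent set of good clauses
  obtain ⟨I, hIG, hIind, hIcard⟩ := shwL_exists_indepSet
    (fun i i' : Fin m => ∃ j j', V (i, j) = V (i', j'))
    (fun i i' ⟨j, j', h⟩ => ⟨j', j, h.symm⟩) (k * D) G
    (fun i hi => by
      rw [hG, mem_filter] at hi
      convert shwL_card_rel_le_low V D i hi.2.2.2 G)
  have hqI : q ≤ I.card := by
    by_contra h
    push Not at h
    have : (k * D + 1) * I.card < (k * D + 1) * q := Nat.mul_lt_mul_of_pos_left h (Nat.succ_pos _)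
    rw [hHc] at hDistG
    omega
  -- solved ⊆ avoiding the violation of every clause of `I`
  have hsub : (univ.filter fun S : Fin m × Fin k → Bool =>
      ∀ i : Fin m, ∃ j : Fin k, A S (V (i, j)) = S (i, j))
        ⊆ univ.filter fun S : Fin m × Fin k → Bool => ∀ i ∈ I, ∃ j, A S (V (i, j)) = S (i, j) := by
    intro S hS
    simp only [mem_filter, mem_univ, true_and] at hS ⊢
    exact fun i _ => hS i
  have havoid := shwL_card_avoid_le_pow V A hA I
    (fun i hi i' hi' hne => by
      have h := hIind i hi i' hi' hne
      push Not at h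
      exact h)
    (fun i hi => by
      have hi' := hIG hi
      rw [hG, mem_filter] at hi'
      refine shwL_card_le_four_pow_mul_card_viol V A hA i hi'.2.1 fun j => ?_
      have hj := hi'.2.2.1 j
      rw [hW, mem_filter, not_and] at hj
      exact not_lt.1 (hj (mem_univ _)))
  have h01 : (0 : ℝ) ≤ 1 - (1 / 4 : ℝ) ^ k := sub_nonneg.2 (pow_le_one₀ (by norm_num) (by norm_num))
  have h1 : 1 - (1 / 4 : ℝ) ^ k ≤ 1 := sub_le_self _ (by positivity)
  calc ((univ.filter fun S : Fin m × Fin k → Bool =>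
        ∀ i : Fin m, ∃ j : Fin k, A S (V (i, j)) = S (i, j)).card : ℝ)
      ≤ ((univ.filter fun S : Fin m × Fin k → Bool =>
          ∀ i ∈ I, ∃ j, A S (V (i, j)) = S (i, j)).card : ℝ) := by exact_mod_cast card_le_card hsub
    _ ≤ (1 - (1 / 4 : ℝ) ^ k) ^ I.card * Fintype.card (Fin m × Fin k → Bool) := havoid
    _ ≤ (1 - (1 / 4 : ℝ) ^ k) ^ q * Fintype.card (Fin m × Fin k → Bool) :=
        mul_le_mul_of_nonneg_right (pow_le_pow_of_le_one h01 h1 hqI) (Nat.cast_nonneg _)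

end ExpSigns

section Advice

/-- **Occurrence-local rules with global advice, one variable pattern.** Let the solver `A` on
the sign cube be occurrence-local GIVEN an advice `h S` taking at most `N` values (output bit `v`
is a function of the polarities of `v`'s occurrences and of `h S` — e.g. `h S` = any `log₂ N`
bits computed from the whole instance). Then `#{S : A S ⊨ (V, S)} ≤ N · (1 - 4^{-k})^q · 2^{mk}`
for every `q` as in `shwL_card_solved_signs_le_pow` (degree cut-off `D`, SDR bound `ν`): on each
fibre `{h = β}` the solver agrees with a genuinely occurrence-local one. -/
theorem shwL_card_solved_signs_le_advice {m k n : ℕ} (V : Fin m × Fin k → Fin n)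
    (A : (Fin m × Fin k → Bool) → (Fin n → Bool)) (N : ℕ)
    (h : (Fin m × Fin k → Bool) → Fin N)
    (hA : ∀ v : Fin n, ∀ S S' : Fin m × Fin k → Bool, h S = h S' →
      (∀ a, V a = v → S a = S' a) → A S v = A S' v)
    (D : ℕ) (ν : ℕ)
    (hν : ∀ W : Finset (Fin m × Fin k), Set.InjOn V (W : Set (Fin m × Fin k)) →
      Set.InjOn Prod.fst (W : Set (Fin m × Fin k)) → W.card ≤ ν)
    (q : ℕ) (hq : (k * D + 1) * q
      ≤ (univ.filter fun i : Fin m => Function.Injective fun j : Fin k => V (i, j)).card - ν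
        - (univ.filter fun i : Fin m => ∃ j : Fin k,
            D < (univ.filter fun a : Fin m × Fin k => V a = V (i, j)).card).card) :
    ((univ.filter fun S : Fin m × Fin k → Bool =>
        ∀ i : Fin m, ∃ j : Fin k, A S (V (i, j)) = S (i, j)).card : ℝ)
      ≤ N * (1 - (1 / 4 : ℝ) ^ k) ^ q * Fintype.card (Fin m × Fin k → Bool) := by
  -- the fibrewise occurrence-local solvers
  set C : Fin n → Fin N → (Fin m × Fin k → Bool) → Finset (Fin m × Fin k → Bool) :=
    fun v β S => univ.filter fun S' : Fin m × Fin k → Bool =>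
      h S' = β ∧ ∀ a, V a = v → S' a = S a with hC
  set F : Fin n → Finset (Fin m × Fin k → Bool) → Bool :=
    fun v X => if hX : X.Nonempty then A hX.choose v else false with hF
  set Aβ : Fin N → (Fin m × Fin k → Bool) → (Fin n → Bool) := fun β S v => F v (C v β S) with hAβ
  have hCloc : ∀ v β, ∀ S S' : Fin m × Fin k → Bool, (∀ a, V a = v → S a = S' a) →
      C v β S = C v β S' := by
    intro v β S S' hSS'
    ext T
    simp only [hC, mem_filter, mem_univ, true_and]
    refine and_congr_right fun _ => forall₂_congr fun a ha => ?_
    rw [hSS' a ha]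
  have hAβloc : ∀ β, ∀ v : Fin n, ∀ S S' : Fin m × Fin k → Bool,
      (∀ a, V a = v → S a = S' a) → Aβ β S v = Aβ β S' v := by
    intro β v S S' hSS'
    simp only [hAβ]
    rw [hCloc v β S S' hSS']
  -- on the fibre of `β = h S`, `Aβ β` agrees with `A`
  have hagree : ∀ S : Fin m × Fin k → Bool, ∀ v, Aβ (h S) S v = A S v := by
    intro S v
    have hne : (C v (h S) S).Nonempty := ⟨S, by simp [hC]⟩
    have hmem := hne.choose_spec
    simp only [hC, mem_filter, mem_univ, true_and] at hmem
    simp only [hAβ, hF, dif_pos hne]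
    exact hA v _ _ hmem.1 hmem.2
  -- union bound over the advice values
  have hsub : (univ.filter fun S : Fin m × Fin k → Bool =>
      ∀ i : Fin m, ∃ j : Fin k, A S (V (i, j)) = S (i, j))
        ⊆ (univ : Finset (Fin N)).biUnion fun β => univ.filter fun S : Fin m × Fin k → Bool =>
            ∀ i : Fin m, ∃ j : Fin k, Aβ β S (V (i, j)) = S (i, j) := by
    intro S hS
    simp only [mem_filter, mem_univ, true_and] at hS
    simp only [mem_biUnion, mem_univ, true_and, mem_filter]
    refine ⟨h S, fun i => ?_⟩
    obtain ⟨j, hj⟩ := hS i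
    exact ⟨j, by rw [hagree]; exact hj⟩
  calc ((univ.filter fun S : Fin m × Fin k → Bool =>
        ∀ i : Fin m, ∃ j : Fin k, A S (V (i, j)) = S (i, j)).card : ℝ)
      ≤ (((univ : Finset (Fin N)).biUnion fun β => univ.filter fun S : Fin m × Fin k → Bool =>
            ∀ i : Fin m, ∃ j : Fin k, Aβ β S (V (i, j)) = S (i, j)).card : ℝ) := by
        exact_mod_cast card_le_card hsub
    _ ≤ ∑ β : Fin N, ((univ.filter fun S : Fin m × Fin k → Bool =>
            ∀ i : Fin m, ∃ j : Fin k, Aβ β S (V (i, j)) = S (i, j)).card : ℝ) := by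
        exact_mod_cast card_biUnion_le
    _ ≤ ∑ _β : Fin N, (1 - (1 / 4 : ℝ) ^ k) ^ q * Fintype.card (Fin m × Fin k → Bool) :=
        sum_le_sum fun β _ => shwL_card_solved_signs_le_pow V (Aβ β) (hAβloc β) D ν hν q hq
    _ = N * (1 - (1 / 4 : ℝ) ^ k) ^ q * Fintype.card (Fin m × Fin k → Bool) := by
        rw [sum_const, card_univ, Fintype.card_fin, nsmul_eq_mul, mul_assoc]

end Advice

end Summit.PneNP.PneNP.Theorems
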